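import Mathlib
import HarnessLib
import HarnessLib.Audit
import Summits.ValiantsHypothesis.ValiantsHypothesis.Theorems.LacunarySymmetroidMatrixDescartesZeroChangeConcavityBudgetGeneral

/-!
# ValiantsHypothesis / LacunarySymmetroid — crux `MatrixDescartes` (stmt-ValiantsHypothesis-18050, V1), LINE (A) «product_plus_one»:
# the CONCAVITY BUDGET on WINDOWS, in the Euler currency of the per-window sector files

Fifth part of the concavity budget (✓ `…ZeroChangeConcavityBudget{,Floor,General,Dip}`).  The per-window sector files of the floor
(`eulerNumerator_roots_Icc_le_one_of_…`, `…Window…`, hands val-lit-p5/p7 and leafhands 3–5) count roots of `eulerNumerator d a 0` on a window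
between consecutive roots of the company product.  This file restates the window-local budget in exactly that currency:

* `posRootSet_euler_bottom_eq` — the positive root SET of `eulerNumerator d a 0` (unfolded) is the positive critical set of
  `Φ = ∏_j row (d₁−d₀) (d₂−d₀) a_{j0} a_{j1} a_{j2}` (the dictionary ✓ `card_posRoots_euler_bottom_eq_posCrit` as an equality of finsets);
* ★ `card_roots_euler_Ioo_le_window_dipBudget` — on a window `(u, v)` free of roots of `Φ` (any company, any support with
  `d₀ ≤ d₁, d₂`): `#{roots of eulerNumerator in (u,v)} ≤ 2·#{DIPS in (u,v)} + 1`, DIP = critical point with `Φ·Φ″ ≥ 0`;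
* ★ `card_roots_euler_Ioo_le_window_badBudget` — the same with the cruder BAD set `M ≤ 0` (`middleSum`);
* ★ `card_roots_euler_Ioo_le_one_of_middleSum_pos` — a root-free window on which `M > 0` at every critical point carries AT MOST ONE root of
  the Euler numerator (e.g. every window in which all `(+,−,−)` rows are switched and all `(+,+,−)` rows unswitched).

HONEST FRAMING: joint / helper, def-free, no named facts, no sorry, standard axioms; closes NO stub by name; `OneChangeFloorK3`, `EulerBoundK3`,
`ClassRowK3Linear`, `PPOPolyLaw`, `MatrixDescartes` (stmt-ValiantsHypothesis-18050) OPEN; `VP ≠ VNP` is NOT proved and nothing here bears on it.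

[folklore] Bookkeeping over the landed concavity-budget files; no citation needed.
-/

set_option linter.dupNamespace false

namespace Summit.ValiantsHypothesis.ValiantsHypothesis.Theorems.LacunarySymmetroidMatrixDescartes

namespace ZeroChange

open Polynomial Finset Filter Topology

/-- **Dictionary as an equality of finsets**: for `d₀ ≤ d₁, d₂` the positive roots of `eulerNumerator d a 0` (unfolded) are exactly the
positive critical points of the normalised row product. -/
theorem posRootSet_euler_bottom_eq {m : ℕ} (d : Fin 3 → ℕ) (h01 : d 0 ≤ d 1) (h02 : d 0 ≤ d 2) (a : Fin m → Fin 3 → ℝ) :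
    ((∑ j, (∑ l, C (a j l * ((d l : ℝ) - d 0)) * X ^ (d l)) * ∏ i ∈ Finset.univ.erase j, (∑ l, C (a i l) * X ^ (d l))
        : ℝ[X]).roots.toFinset.filter (fun t => 0 < t))
      = (derivative (∏ j, row (d 1 - d 0) (d 2 - d 0) (a j 0) (a j 1) (a j 2))).roots.toFinset.filter (fun t => 0 < t) := by
  classical
  rw [euler_bottom_eq_X_pow_mul_derivative d h01 h02 a]
  set D := derivative (∏ j, row (d 1 - d 0) (d 2 - d 0) (a j 0) (a j 1) (a j 2)) with hD
  by_cases hD0 : D = 0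
  · simp [hD0]
  ext t
  simp only [Finset.mem_filter, Multiset.mem_toFinset]
  rw [mem_roots (mul_ne_zero (pow_ne_zero _ X_ne_zero) hD0), mem_roots hD0, IsRoot.def, IsRoot.def, eval_mul, eval_pow,
    eval_X, mul_eq_zero]
  constructor
  · rintro ⟨h | h, ht⟩
    · exact absurd ((pow_eq_zero_iff (by omega : m * d 0 + 1 ≠ 0)).1 h) ht.ne'
    · exact ⟨h, ht⟩
  · rintro ⟨h, ht⟩
    exact ⟨Or.inr h, ht⟩

/-- ★ **Window budget, DIP form, Euler currency**: on a window `(u, v)` free of roots of the row product, the roots of `eulerNumerator d a 0`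
number at most `2·#{critical points t ∈ (u,v) with Φ(t)·Φ″(t) ≥ 0} + 1` (any company, `d₀ < d₁ < d₂` not even needed beyond `d₀ ≤ d₁, d₂`). -/
theorem card_roots_euler_Ioo_le_window_dipBudget {m : ℕ} (d : Fin 3 → ℕ) (h01 : d 0 ≤ d 1) (h02 : d 0 ≤ d 2)
    (a : Fin m → Fin 3 → ℝ) {u v : ℝ}
    (hnoroot : ∀ z, u < z → z < v → (∏ j, row (d 1 - d 0) (d 2 - d 0) (a j 0) (a j 1) (a j 2)).eval z ≠ 0) :
    (((∑ j, (∑ l, C (a j l * ((d l : ℝ) - d 0)) * X ^ (d l)) * ∏ i ∈ Finset.univ.erase j, (∑ l, C (a i l) * X ^ (d l))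
        : ℝ[X]).roots.toFinset.filter (fun t => 0 < t)).filter (fun t => u < t ∧ t < v)).card
      ≤ 2 * (((derivative (∏ j, row (d 1 - d 0) (d 2 - d 0) (a j 0) (a j 1) (a j 2))).roots.toFinset.filter
            (fun t => 0 < t)).filter
          (fun t => (u < t ∧ t < v) ∧ ¬ ((∏ j, row (d 1 - d 0) (d 2 - d 0) (a j 0) (a j 1) (a j 2)).eval t *
            (derivative (derivative (∏ j, row (d 1 - d 0) (d 2 - d 0) (a j 0) (a j 1) (a j 2)))).eval t < 0))).card + 1 := by
  rw [posRootSet_euler_bottom_eq d h01 h02 a]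
  exact card_crit_Ioo_le_two_mul_card_notGood_add_one _ hnoroot

/-- ★ **Window budget, BAD form, Euler currency**: on a root-free window `(u, v)` of a company on `d₀ < d₁ < d₂`, the roots of
`eulerNumerator d a 0` number at most `2·#{critical points t ∈ (u,v) with M(t) ≤ 0} + 1`. -/
theorem card_roots_euler_Ioo_le_window_badBudget {m : ℕ} (d : Fin 3 → ℕ) (h01 : d 0 < d 1) (h12 : d 1 < d 2)
    (a : Fin m → Fin 3 → ℝ) {u v : ℝ}
    (hnoroot : ∀ z, u < z → z < v → (∏ j, row (d 1 - d 0) (d 2 - d 0) (a j 0) (a j 1) (a j 2)).eval z ≠ 0) :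
    (((∑ j, (∑ l, C (a j l * ((d l : ℝ) - d 0)) * X ^ (d l)) * ∏ i ∈ Finset.univ.erase j, (∑ l, C (a i l) * X ^ (d l))
        : ℝ[X]).roots.toFinset.filter (fun t => 0 < t)).filter (fun t => u < t ∧ t < v)).card
      ≤ 2 * (((derivative (∏ j, row (d 1 - d 0) (d 2 - d 0) (a j 0) (a j 1) (a j 2))).roots.toFinset.filter
            (fun t => 0 < t)).filter
          (fun t => (u < t ∧ t < v) ∧ middleSum (d 1 - d 0) (d 2 - d 0) (fun j => (a j 0, a j 1, a j 2)) t ≤ 0)).card + 1 := by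
  rw [posRootSet_euler_bottom_eq d h01.le (h01.le.trans h12.le) a]
  exact card_crit_Ioo_prod_rows_le m (d 1 - d 0) (d 2 - d 0) (by omega) (by omega) (fun j => (a j 0, a j 1, a j 2)) hnoroot

/-- ★ **At most one Euler root on a window where the middle letters win**: on a root-free window `(u, v)` of a company on
`d₀ < d₁ < d₂` such that `M(t) > 0` at every critical point `t ∈ (u, v)`, `eulerNumerator d a 0` has at most one root in `(u, v)`. -/
theorem card_roots_euler_Ioo_le_one_of_middleSum_pos {m : ℕ} (d : Fin 3 → ℕ) (h01 : d 0 < d 1) (h12 : d 1 < d 2)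
    (a : Fin m → Fin 3 → ℝ) {u v : ℝ}
    (hnoroot : ∀ z, u < z → z < v → (∏ j, row (d 1 - d 0) (d 2 - d 0) (a j 0) (a j 1) (a j 2)).eval z ≠ 0)
    (hM : ∀ t, u < t → t < v →
      (derivative (∏ j, row (d 1 - d 0) (d 2 - d 0) (a j 0) (a j 1) (a j 2))).eval t = 0 →
      0 < middleSum (d 1 - d 0) (d 2 - d 0) (fun j => (a j 0, a j 1, a j 2)) t) :
    (((∑ j, (∑ l, C (a j l * ((d l : ℝ) - d 0)) * X ^ (d l)) * ∏ i ∈ Finset.univ.erase j, (∑ l, C (a i l) * X ^ (d l))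
        : ℝ[X]).roots.toFinset.filter (fun t => 0 < t)).filter (fun t => u < t ∧ t < v)).card ≤ 1 := by
  rw [posRootSet_euler_bottom_eq d h01.le (h01.le.trans h12.le) a]
  exact card_crit_Ioo_le_one_of_middleSum_pos m (d 1 - d 0) (d 2 - d 0) (by omega) (by omega)
    (fun j => (a j 0, a j 1, a j 2)) hnoroot hM

end ZeroChange

end Summit.ValiantsHypothesis.ValiantsHypothesis.Theorems.LacunarySymmetroidMatrixDescartes
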